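import Mathlib
import Literature.Probability.Percolation.Percolation
import Literature.Probability.Percolation.RSW
import Literature.Probability.Percolation.PlanarDuality
import Literature.Probability.Percolation.LayerPeeling
import Literature.Probability.Percolation.LayerGluing
import Literature.Probability.Percolation.LatticeSymmetry
import Literature.Probability.Percolation.DiagonalStripColumns
import Literature.Probability.Percolation.DiagonalColumnPatterns
import HarnessLib

/-!
# The junction of the diagonal strip: the wall event from the two seam patterns

Topic `Literature/Probability/Percolation`. Dictionary step (i) of the named fact
`Literature.Probability.Percolation.IkhlefPonsaingFirstPassage` (Ikhlef–Ponsaing, J. Stat. Phys.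
149 (2012), arXiv:1202.5476, §3.1 and Def. 4.1: "The first site passage probability is given by
`P_b^{(L)} = ⟨Ψ|ρ|Ψ⟩/⟨Ψ|Ψ⟩`, where `ρ` acts between a link pattern and a rotated link pattern,
giving `1` if the open path formed by these two link patterns goes through the first site, and `0`
if it does not"), in the cluster language of the named fact:

* `ipHalfR m c a'`, `ipSeg m a a'` — the part right of a column and a finite piece
  `a ≤ x₀ - x₁ ≤ a'` of the strip (`ipStrip_inter_abs_le_eq_ipSeg`: the truncations of
  `tendsto_ipPassage_trunc` are the pieces `ipSeg m (-N) N`); `ipSeg = ipHalf ∪ ipHalfR` along any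
  column, with no lattice edge across (`not_adj_ipHalf_ipHalfR`).
* The transposition `(x₀, x₁) ↦ (x₁, x₀)` (`transposeIso` of `LatticeSymmetry.lean`) maps column `c`
  to column `-c` site by site (`transposeIso_colSite`), preserves levels, and swaps right and left
  parts (`transposeIso_image_ipHalfR`); hence right-part connections of `ω` are left-part
  connections of the transposed configuration (`openConnIn_ipHalfR_iff`) — IP12's "rotated
  lattice" for `⟨Ψ|`.
* `ipJunction m j P P'` — the Boolean junction functional (IP12's `ρ`): some seam site equivalent to
  `j` under the closure of `P.1 ∨ P'.1` touches the wall in `P` or in `P'`; and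
  **`wall_ipSeg_iff_ipJunction`**: for a lattice configuration and `a ≤ c ≤ a'`, the site
  `colSite c j` is joined to the wall inside the piece iff
  `ipJunction m j (colPattern ω m a c) (colPattern ωᵗ m (-a') (-c))`, `ωᵗ` the transposed
  configuration.

With `colPattern_eq_colIter` (`DiagonalColumnPatterns.lean`) both arguments are iterates of the
column update over the edge layers of the two sides, which are disjoint; averaging (independence,
the stochastic matrix and its Perron vector, IP12 §3.1 `t^N|in⟩ → Ψ`) is the remaining,
probabilistic, half of the dictionary.

## References

* Y. Ikhlef, A. K. Ponsaing, J. Stat. Phys. 149 (2012) 10–36, arXiv:1202.5476, §3.1, Def. 4.1.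
  [IkhlefPonsaing2012]
-/

namespace Literature.Probability.Percolation

open Literature.Probability.LatticeModels

/-! ### The right part of a finite piece of the strip, and the transposition symmetry -/

section RightRegion

/-- The columns `c ≤ x₀ - x₁ ≤ a'` of the strip (the region to the right of column `c` in a finite
piece). [cite: IkhlefPonsaing2012, §3.1] -/
def ipHalfR (m : ℕ) (c a' : ℤ) : Set (Site 2) := ipStrip m ∩ {x | c ≤ x 0 - x 1 ∧ x 0 - x 1 ≤ a'}

/-- The finite piece `a ≤ x₀ - x₁ ≤ a'` of the strip. [cite: IkhlefPonsaing2012, §3.1] -/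
def ipSeg (m : ℕ) (a a' : ℤ) : Set (Site 2) := ipStrip m ∩ {x | a ≤ x 0 - x 1 ∧ x 0 - x 1 ≤ a'}

/-- The truncated strips of `tendsto_ipPassage_trunc` are the symmetric pieces `ipSeg m (-N) N`. [folklore] -/
theorem ipStrip_inter_abs_le_eq_ipSeg (m N : ℕ) :
    {x : Site 2 | 0 ≤ x 0 + x 1 ∧ x 0 + x 1 ≤ ((2 * m + 1 : ℕ) : ℤ)} ∩ {x : Site 2 | |x 0 - x 1| ≤ (N : ℤ)} =
      ipSeg m (-N) N := by
  ext x
  simp only [ipSeg, ipStrip, Set.mem_inter_iff, Set.mem_setOf_eq, abs_le]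

/-- A finite piece is the union of its parts left and right of any of its columns. [folklore] -/
theorem ipSeg_eq_union (m : ℕ) {a c a' : ℤ} (hac : a ≤ c) (hca : c ≤ a') :
    ipSeg m a a' = ipHalf m a c ∪ ipHalfR m c a' := by
  ext x
  simp only [ipSeg, ipHalf, ipHalfR, ipBox, Set.mem_inter_iff, Set.mem_setOf_eq, Set.mem_union]
  constructor
  · rintro ⟨hS, h1, h2⟩
    rcases le_or_gt (x 0 - x 1) c with h | h
    · exact Or.inl ⟨⟨hS, h1⟩, h⟩
    · exact Or.inr ⟨hS, h.le, h2⟩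
  · rintro (⟨⟨hS, h1⟩, h2⟩ | ⟨hS, h1, h2⟩)
    · exact ⟨hS, h1, by omega⟩
    · exact ⟨hS, by omega, h2⟩

/-- The seam column lies in the left part. [folklore] -/
theorem ipCol_subset_ipHalf {m : ℕ} {a c : ℤ} (hac : a ≤ c) : ipCol m c ⊆ ipHalf m a c := by
  rintro x ⟨hS, h⟩
  simp only [Set.mem_setOf_eq] at h
  exact ⟨⟨hS, by simp only [Set.mem_setOf_eq]; omega⟩, by simp only [Set.mem_setOf_eq]; omega⟩

/-- The seam column lies in the right part. [folklore] -/
theorem ipCol_subset_ipHalfR {m : ℕ} {c a' : ℤ} (hca : c ≤ a') : ipCol m c ⊆ ipHalfR m c a' := by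
  rintro x ⟨hS, h⟩
  simp only [Set.mem_setOf_eq] at h
  exact ⟨hS, by simp only [Set.mem_setOf_eq]; omega⟩

/-- No lattice edge joins the left part minus the seam to the right part minus the seam (their
`x₀ - x₁` differ by at least `2`). [folklore] -/
theorem not_adj_ipHalf_ipHalfR {ω : BondConfig (Site 2)} (hω : ω ⊆ (zdGraph 2).edgeSet) (m : ℕ)
    (a c a' : ℤ) :
    ∀ u ∈ ipHalf m a c, u ∉ ipCol m c → ∀ v ∈ ipHalfR m c a', v ∉ ipCol m c →
      ¬ (openGraph ω).Adj u v := by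
  intro u hu huc v hv hvc hadj
  have hu' : u 0 - u 1 < c := by
    have h1 : u 0 - u 1 ≤ c := hu.2
    have h2 : ¬ (u 0 - u 1 = c) := fun h => huc ⟨hu.1.1, h⟩
    omega
  have hv' : c < v 0 - v 1 := by
    have h1 : c ≤ v 0 - v 1 := hv.2.1
    have h2 : ¬ (v 0 - v 1 = c) := fun h => hvc ⟨hv.1, h⟩
    omega
  have hadjZ : (zdGraph 2).Adj u v := hω ((openGraph_adj ω _ _).1 hadj).1
  rcases zdGraph_two_adj_sub_sub hadjZ with h | h <;> omega

/-- The transposition `(x₀, x₁) ↦ (x₁, x₀)` maps the `j`-th site of column `c` to the `j`-th site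
of column `-c`. [folklore] -/
theorem transposeIso_colSite (c : ℤ) (j : ℕ) :
    transposeIso (colSite c j) = colSite (-c) j := by
  rw [transposeIso_apply]
  ext i
  fin_cases i
  · show colSite c j 1 = colSite (-c) j 0
    rw [colSite_one, colSite_zero]; omega
  · show colSite c j 0 = colSite (-c) j 1
    rw [colSite_zero, colSite_one]; omega

/-- The transposition preserves the level `x₀ + x₁` (hence the strip and the wall). [folklore] -/
theorem transposeIso_level (x : Site 2) : transposeIso x 0 + transposeIso x 1 = x 0 + x 1 := by
  rw [transposeIso_apply_zero, transposeIso_apply_one, add_comm]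

/-- The transposition maps the right part `c ≤ x₀ - x₁ ≤ a'` onto the left part
`-a' ≤ x₀ - x₁ ≤ -c`. [folklore] -/
theorem transposeIso_image_ipHalfR (m : ℕ) (c a' : ℤ) :
    (transposeIso : Site 2 → Site 2) '' ipHalfR m c a' = ipHalf m (-a') (-c) := by
  rw [image_transposeIso]
  ext x
  simp only [Set.mem_preimage, ipHalfR, ipHalf, ipBox, ipStrip, Set.mem_inter_iff, Set.mem_setOf_eq,
    transposeIso_apply_zero, transposeIso_apply_one]
  omega

/-- The transposition is an involution (pointwise; cf. `transposeIso_transposeIso` of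
`TriHexLemma.lean`, not imported here). [folklore] -/
private theorem transposeIso_transposeIso' (z : Site 2) : transposeIso (transposeIso z) = z := by
  rw [transposeIso_apply, transposeIso_apply]
  ext i
  fin_cases i <;> rfl

/-- The transposition maps the left part `a ≤ x₀ - x₁ ≤ c` onto the right part
`-c ≤ x₀ - x₁ ≤ -a`. [folklore] -/
theorem transposeIso_image_ipHalf (m : ℕ) (a c : ℤ) :
    (transposeIso : Site 2 → Site 2) '' ipHalf m a c = ipHalfR m (-c) (-a) := by
  rw [image_transposeIso]
  ext x
  simp only [Set.mem_preimage, ipHalfR, ipHalf, ipBox, ipStrip, Set.mem_inter_iff, Set.mem_setOf_eq,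
    transposeIso_apply_zero, transposeIso_apply_one]
  omega

/-- **Right-part connections are left-part connections of the transposed configuration.**
[folklore] -/
theorem openConnIn_ipHalfR_iff (ω : BondConfig (Site 2)) (m : ℕ) (c a' : ℤ) (x y : Site 2) :
    ω ∈ openConnIn (ipHalfR m c a') x y ↔
      BondConfig.relabel (sym2Equiv (transposeIso : zdGraph 2 ≃g zdGraph 2).toEquiv) ω ∈
        openConnIn (ipHalf m (-a') (-c)) (transposeIso x) (transposeIso y) := by
  have hτ : (((transposeIso : zdGraph 2 ≃g zdGraph 2).toEquiv : Site 2 ≃ Site 2) : Site 2 → Site 2) =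
      (transposeIso : Site 2 → Site 2) := funext fun _ => rfl
  have hτs : (((transposeIso : zdGraph 2 ≃g zdGraph 2).toEquiv.symm : Site 2 ≃ Site 2) : Site 2 → Site 2) =
      (transposeIso : Site 2 → Site 2) := funext fun z => transposeIso_symm_apply z
  constructor
  · intro h
    have h' := relabel_mem_openConnIn (transposeIso : zdGraph 2 ≃g zdGraph 2).toEquiv h
    rw [hτ, transposeIso_image_ipHalfR] at h'
    exact h'
  · intro h
    have h' := relabel_mem_openConnIn (transposeIso : zdGraph 2 ≃g zdGraph 2).toEquiv.symm h
    rw [relabel_symm_relabel, hτs, transposeIso_image_ipHalf, transposeIso_transposeIso',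
      transposeIso_transposeIso', neg_neg, neg_neg] at h'
    exact h'

end RightRegion

/-! ### The junction: the wall event of a finite piece from the two seam patterns -/

section Junction

open Classical in
/-- **The junction functional** `J(P, P')` at the seam site `j`: some seam site glue-equivalent to
`j` (closure of "joined on the left" ∪ "joined on the right") touches the wall on the left or on
the right — IP12's `ρ`, in the cluster language. [cite: IkhlefPonsaing2012, Def. 4.1] -/
noncomputable def ipJunction (m : ℕ) (j : Fin (m + 1)) (P P' : ColPattern m) : Bool :=
  decide (∃ f : Fin (m + 1),
    Relation.EqvGen (fun i i' : Fin (m + 1) => P.1 i i' = true ∨ P'.1 i i' = true) j f ∧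
      (P.2 f = true ∨ P'.2 f = true))

variable {ω : BondConfig (Site 2)}

/-- **The wall event of a finite piece is the junction of the two seam patterns**: for a lattice
configuration, `a ≤ c ≤ a'` and a seam site `b = colSite c j`, `b` is joined to the wall inside the
piece `a ≤ x₀ - x₁ ≤ a'` iff `J(P, P')` holds for the left pattern `P` of `ω` at column `c` (piece
truncated at `a`) and the left pattern `P'` at column `-c` of the TRANSPOSED configuration (piece
truncated at `-a'`), i.e. the right pattern of `ω`. (IP12 Def. 4.1:
`P_b = ⟨Ψ|ρ|Ψ⟩/⟨Ψ|Ψ⟩`, with `⟨Ψ|` the ground state "of the rotated lattice".)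
[cite: IkhlefPonsaing2012, Def. 4.1] -/
theorem wall_ipSeg_iff_ipJunction (hω : ω ⊆ (zdGraph 2).edgeSet) (m : ℕ) {a c a' : ℤ}
    (hac : a ≤ c) (hca : c ≤ a') (j : Fin (m + 1)) :
    (∃ w : Site 2, w 0 + w 1 = 0 ∧ ω ∈ openConnIn (ipSeg m a a') (colSite c j) w) ↔
      ipJunction m j (colPattern ω m a c)
        (colPattern (BondConfig.relabel (sym2Equiv (transposeIso : zdGraph 2 ≃g zdGraph 2).toEquiv) ω)
          m (-a') (-c)) = true := by
  set ω' := BondConfig.relabel (sym2Equiv (transposeIso : zdGraph 2 ≃g zdGraph 2).toEquiv) ω with hω'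
  have hjF : colSite c j ∈ ipCol m c := colSite_mem_ipCol (Nat.lt_succ_iff.1 j.2)
  rw [ipSeg_eq_union m hac hca,
    wall_union_iff_glue (ipCol_subset_ipHalf hac) (ipCol_subset_ipHalfR hca)
      (not_adj_ipHalf_ipHalfR hω m a c a') (fun w : Site 2 => w 0 + w 1 = 0) hjF]
  simp only [ipJunction, decide_eq_true_eq]
  -- transport the seam relation along `i ↦ colSite c i`
  have hφ : Function.Injective (fun i : Fin (m + 1) => colSite c i) :=
    fun i i' h => Fin.ext (colSite_injective c h)
  have hR : ∀ i i' : Fin (m + 1),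
      (colSite c i ∈ ipCol m c ∧ colSite c i' ∈ ipCol m c ∧
        (ω ∈ openConnIn (ipHalf m a c) (colSite c i) (colSite c i') ∨
          ω ∈ openConnIn (ipHalfR m c a') (colSite c i) (colSite c i'))) ↔
      ((colPattern ω m a c).1 i i' = true ∨ (colPattern ω' m (-a') (-c)).1 i i' = true) := by
    intro i i'
    simp only [colPattern, decide_eq_true_eq]
    rw [openConnIn_ipHalfR_iff, transposeIso_colSite, transposeIso_colSite]
    exact ⟨fun ⟨_, _, h⟩ => h, fun h => ⟨colSite_mem_ipCol (Nat.lt_succ_iff.1 i.2),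
      colSite_mem_ipCol (Nat.lt_succ_iff.1 i'.2), h⟩⟩
  have hrange : ∀ u v : Site 2,
      (u ∈ ipCol m c ∧ v ∈ ipCol m c ∧
        (ω ∈ openConnIn (ipHalf m a c) u v ∨ ω ∈ openConnIn (ipHalfR m c a') u v)) →
      u ∈ Set.range (fun i : Fin (m + 1) => colSite c i) ∧
        v ∈ Set.range (fun i : Fin (m + 1) => colSite c i) := by
    rintro u v ⟨hu, hv, -⟩
    obtain ⟨i, hi, rfl⟩ := exists_eq_colSite_of_mem_ipCol hu
    obtain ⟨i', hi', rfl⟩ := exists_eq_colSite_of_mem_ipCol hv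
    exact ⟨⟨⟨i, Nat.lt_succ_iff.2 hi⟩, rfl⟩, ⟨⟨i', Nat.lt_succ_iff.2 hi'⟩, rfl⟩⟩
  have hwall : ∀ i : Fin (m + 1),
      ((∃ w : Site 2, w 0 + w 1 = 0 ∧ ω ∈ openConnIn (ipHalf m a c) (colSite c i) w) ∨
        (∃ w : Site 2, w 0 + w 1 = 0 ∧ ω ∈ openConnIn (ipHalfR m c a') (colSite c i) w)) ↔
      ((colPattern ω m a c).2 i = true ∨ (colPattern ω' m (-a') (-c)).2 i = true) := by
    intro i
    simp only [colPattern, decide_eq_true_eq]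
    refine or_congr Iff.rfl ⟨?_, ?_⟩
    · rintro ⟨w, hw0, hc⟩
      refine ⟨transposeIso w, by rw [transposeIso_level]; exact hw0, ?_⟩
      rw [← transposeIso_colSite]
      exact (openConnIn_ipHalfR_iff ω m c a' _ _).1 hc
    · rintro ⟨w, hw0, hc⟩
      refine ⟨transposeIso w, by rw [transposeIso_level]; exact hw0, ?_⟩
      rw [openConnIn_ipHalfR_iff, transposeIso_colSite, transposeIso_transposeIso']
      exact hc
  constructor
  · rintro ⟨f, hf, he, hw⟩
    obtain ⟨i, hi, rfl⟩ := exists_eq_colSite_of_mem_ipCol hf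
    refine ⟨⟨i, Nat.lt_succ_iff.2 hi⟩, ?_, (hwall ⟨i, Nat.lt_succ_iff.2 hi⟩).1 hw⟩
    exact (eqvGen_iff_of_injective (fun i : Fin (m + 1) => colSite c i) hφ hR hrange j
      ⟨i, Nat.lt_succ_iff.2 hi⟩).1 he
  · rintro ⟨i, he, hw⟩
    refine ⟨colSite c i, colSite_mem_ipCol (Nat.lt_succ_iff.1 i.2), ?_, (hwall i).2 hw⟩
    exact (eqvGen_iff_of_injective (fun i : Fin (m + 1) => colSite c i) hφ hR hrange j i).2 he

end Junction

end Literature.Probability.Percolation
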